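import Summits.CriticalPhenomena.Ising3DConformalLimit.Theses.PersistenceSpeed
import Literature.Probability.LatticeModels.HighDimPointwiseTriviality
import Literature.Probability.LatticeModels.PointwiseScalingLimitScale
import HarnessLib

/-!
# Crux `U4OfBoundarySignal` (item stmt-CriticalPhenomena-18095) — structure of the statement and its
# load-bearing hypothesis (refuter birth vetting, 2026-08-17)

THEOREM-ONLY negative / structural lemmas (no definition, no named fact, no `sorry`, no positive route-item
conclusion). The crux of route `PersistenceSpeed` reads
`BoundedBoundarySignal → ∀ ρ Δ S, (ρ > 0 on (0,1]) → HasPointwiseScalingLimit (criticalCorr 3) ρ S →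
 IsNondegenerateTwoPoint S → IsTranslationInvariant S → IsScaleCovariant Δ S → HasNontrivialU4 S`.

* `forall_limits_iff_exists_limit` (any `d ≥ 1`, any lattice family): once one non-degenerate pointwise
  scaling limit exists, "every non-degenerate limit has `U₄ ≢ 0`" is equivalent to "some non-degenerate
  limit has `U₄ ≢ 0`" — by uniqueness of pointwise scaling limits up to one positive scale (tree
  theorems `HasPointwiseScalingLimit.exists_scale_of_isNondegenerateTwoPoint`,
  `hasNontrivialU4_iff_of_scale`). So the crux's universal quantifier over `(ρ, Δ, S)` is not a
  strengthening of clause (iii), and (recorded in the crux workfile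
  `Cruxes/U4OfBoundarySignal/Disproof.lean`) the summit conjunct implies the crux: an unconditional
  refutation of the crux would refute `Ising3DConformalLimit`.
* `exists_trivial_limit_criticalCorr_three`: the zero family is a pointwise scaling limit of the critical
  correlators of `ℤ³` (renormalisation `ρ δ = δ`, from `|⟨∏σ⟩| ≤ 1`), translation invariant, scale covariant
  for every `Δ`, with `U₄ ≡ 0` and degenerate two-point function.
* `u4OfBoundarySignal_false_without_nondegeneracy`, `u4OfBoundarySignal_without_nondegeneracy_iff`: the
  hypothesis `IsNondegenerateTwoPoint S` is load-bearing — with it dropped, the crux is equivalent to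
  `¬ BoundedBoundarySignal`, the negation of the route's other crux.

References: uniqueness of the renormalisation up to constants accompanies Chelkak–Hongler–Izyurov,
Ann. Math. 181 (2015), Thm 1.1 (tree file `PointwiseScalingLimitScale.lean`); the bound
`|⟨∏σ⟩⁺_{β_c}| ≤ 1` is the tree theorem `abs_criticalCorr_le_one`.
-/

open Filter
open scoped Topology
open Literature.Probability.LatticeModels
open Summit.CriticalPhenomena.Ising3DConformalLimit.Theses.PersistenceSpeed

namespace Summit.CriticalPhenomena.Ising3DConformalLimit.U4OfBoundarySignalNegative

variable {d : ℕ}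

/-- Once one non-degenerate pointwise scaling limit of `G` exists (`d ≥ 1`), "every non-degenerate
limit has `U₄ ≢ 0`" is equivalent to "some non-degenerate limit has `U₄ ≢ 0`": the universal
quantifier over `(ρ, S)` in the crux `U4OfBoundarySignal` is not a strengthening of clause (iii).
[folklore] -/
theorem forall_limits_iff_exists_limit (hd : 0 < d) {G : LatticeCorrFamily d}
    (hex : ∃ (ρ : ℝ → ℝ) (S : CorrFamily d), (∀ δ ∈ Set.Ioc (0:ℝ) 1, 0 < ρ δ) ∧
      HasPointwiseScalingLimit G ρ S ∧ IsNondegenerateTwoPoint S) :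
    (∀ (ρ : ℝ → ℝ) (S : CorrFamily d), (∀ δ ∈ Set.Ioc (0:ℝ) 1, 0 < ρ δ) →
      HasPointwiseScalingLimit G ρ S → IsNondegenerateTwoPoint S → HasNontrivialU4 S) ↔
    (∃ (ρ : ℝ → ℝ) (S : CorrFamily d), (∀ δ ∈ Set.Ioc (0:ℝ) 1, 0 < ρ δ) ∧
      HasPointwiseScalingLimit G ρ S ∧ IsNondegenerateTwoPoint S ∧ HasNontrivialU4 S) := by
  obtain ⟨ρ, S, hρ, hlim, hnd⟩ := hex
  constructor
  · intro hall
    exact ⟨ρ, S, hρ, hlim, hnd, hall ρ S hρ hlim hnd⟩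
  · rintro ⟨ρ₁, S₁, hρ₁, hlim₁, hnd₁, hU₁⟩ ρ₂ S₂ hρ₂ hlim₂ hnd₂
    obtain ⟨c, hc, hscale⟩ :=
      hlim₁.exists_scale_of_isNondegenerateTwoPoint hd hρ₁ hρ₂ hlim₂ hnd₁ hnd₂
    exact (hasNontrivialU4_iff_of_scale hc.ne' hscale).2 hU₁

/-- **The degenerate witness.** The zero family (`S 0 = ⟨1⟩⁺_{β_c}`, `S n ≡ 0` for `n ≥ 1`) is a
pointwise scaling limit of the critical correlators of `ℤ³` under the positive renormalisation
`ρ δ = δ` (because `|⟨∏ σ⟩⁺_{β_c}| ≤ 1`); it is translation invariant, scale covariant for EVERY `Δ`,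
has `U₄ ≡ 0`, and its two-point function is degenerate. [folklore] -/
theorem exists_trivial_limit_criticalCorr_three :
    ∃ S : CorrFamily 3, HasPointwiseScalingLimit (criticalCorr 3) (fun δ => δ) S ∧
      IsTranslationInvariant S ∧ (∀ Δ : ℝ, IsScaleCovariant Δ S) ∧ ¬ HasNontrivialU4 S ∧
      ¬ IsNondegenerateTwoPoint S := by
  refine ⟨fun n _ => if n = 0 then criticalCorr 3 0 ![] else 0, ?_, ?_, ?_, ?_, ?_⟩
  · intro n
    apply TendstoUniformlyOn.tendstoLocallyUniformlyOn
    rw [Metric.tendstoUniformlyOn_iff]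
    intro ε hε
    have hev : ∀ᶠ δ in 𝓝[>] (0:ℝ), δ ∈ Set.Ioc (0:ℝ) (min 1 (ε / 2)) :=
      Ioc_mem_nhdsGT (lt_min zero_lt_one (half_pos hε))
    filter_upwards [hev] with δ hδ x _
    obtain ⟨hδ0, hδ1⟩ := hδ
    have hδle1 : δ ≤ 1 := hδ1.trans (min_le_left _ _)
    have hδlt : δ < ε := (hδ1.trans (min_le_right _ _)).trans_lt (half_lt_self hε)
    by_cases hn : n = 0
    · subst hn
      have hx : (fun i => latticeApprox δ (x i)) = (![] : Fin 0 → Site 3) := Subsingleton.elim _ _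
      simp [rescaledCorrelator_apply, hx, hε]
    · simp only [hn, ↓reduceIte, rescaledCorrelator_apply, dist_zero_left, norm_mul, norm_pow,
        Real.norm_eq_abs]
      have hG := abs_criticalCorr_le_one (d := 3) le_rfl n (fun i => latticeApprox δ (x i))
      have hδn : |δ| ^ n ≤ δ := by
        rw [abs_of_pos hδ0]
        calc δ ^ n ≤ δ ^ 1 := pow_le_pow_of_le_one hδ0.le hδle1 (Nat.one_le_iff_ne_zero.2 hn)
          _ = δ := pow_one δ
      calc |δ| ^ n * |criticalCorr 3 n fun i => latticeApprox δ (x i)| ≤ δ * 1 :=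
            mul_le_mul hδn hG (abs_nonneg _) hδ0.le
        _ < ε := by rw [mul_one]; exact hδlt
  · intro n v x; rfl
  · intro Δ n c hc x
    by_cases hn : n = 0
    · subst hn; simp
    · simp [hn]
  · rintro ⟨x, -, hx⟩
    apply hx
    simp [limitConnectedFour]
  · intro hnd
    have h01 : (![0, EuclideanSpace.single (0 : Fin 3) (1 : ℝ)] : Fin 2 → EuclideanSpace ℝ (Fin 3)) ∈
        NonCoincident 3 2 := by
      rw [mem_nonCoincident]
      intro i j hij
      fin_cases i <;> fin_cases j
      · rfl
      · exfalso
        have := congrArg (fun v : EuclideanSpace ℝ (Fin 3) => v 0) hij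
        simp at this
      · exfalso
        have := congrArg (fun v : EuclideanSpace ℝ (Fin 3) => v 0) hij
        simp at this
      · rfl
    have := hnd _ h01
    simp at this

/-- **Non-degeneracy is load-bearing in `U4OfBoundarySignal`**: given `BoundedBoundarySignal`, the
crux with the hypothesis `IsNondegenerateTwoPoint S` dropped is FALSE (the zero family of
`exists_trivial_limit_criticalCorr_three` is a counterexample). Any proof of the crux must use
non-degeneracy. [folklore] -/
theorem u4OfBoundarySignal_false_without_nondegeneracy (hB : BoundedBoundarySignal) :
    ¬ (BoundedBoundarySignal → ∀ (ρ : ℝ → ℝ) (Δ : ℝ) (S : CorrFamily 3),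
        (∀ δ ∈ Set.Ioc (0:ℝ) 1, 0 < ρ δ) → HasPointwiseScalingLimit (criticalCorr 3) ρ S →
        IsTranslationInvariant S → IsScaleCovariant Δ S → HasNontrivialU4 S) := by
  intro h
  obtain ⟨S, hlim, htr, hsc, hU, -⟩ := exists_trivial_limit_criticalCorr_three
  exact hU (h hB (fun δ => δ) 0 S (fun δ hδ => hδ.1) hlim htr (hsc 0))

/-- With non-degeneracy dropped, the crux `U4OfBoundarySignal` is EQUIVALENT to the negation of the
route's other crux `BoundedBoundarySignal`. [folklore] -/
theorem u4OfBoundarySignal_without_nondegeneracy_iff :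
    (BoundedBoundarySignal → ∀ (ρ : ℝ → ℝ) (Δ : ℝ) (S : CorrFamily 3),
        (∀ δ ∈ Set.Ioc (0:ℝ) 1, 0 < ρ δ) → HasPointwiseScalingLimit (criticalCorr 3) ρ S →
        IsTranslationInvariant S → IsScaleCovariant Δ S → HasNontrivialU4 S) ↔
      ¬ BoundedBoundarySignal :=
  ⟨fun h hB => u4OfBoundarySignal_false_without_nondegeneracy hB h, fun hnB hB => absurd hB hnB⟩

end Summit.CriticalPhenomena.Ising3DConformalLimit.U4OfBoundarySignalNegative
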